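import Literature.NumberTheory.LFunctions.BettinConreyFarmer2013
import Literature.NumberTheory.LFunctions.ZetaOrdinateDictionary
import Literature.NumberTheory.LFunctions.ZetaRealAxis
import Literature.NumberTheory.LFunctions.LevinsonMontgomery
import HarnessLib

/-!
# Bettin–Conrey–Farmer 2013, Theorem 1 — bookkeeping of the zeros under RH and condition (2)

Topic `Literature/NumberTheory/LFunctions`; first "Proofs" companion of
`BettinConreyFarmer2013.lean` (the named fact `BettinConreyFarmer2013_thm1`). Everything in this
file is PROVED (no named facts, no definitions). We work with the set
`𝒵 = ZetaZeros.riemannZetaNontrivialZeros` of non-trivial zeros (each listed once) and unpack the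
paper's hypotheses — RH, simplicity, and condition (2)
`∑_{0 < Im ρ ≤ T} |ζ'(ρ)|⁻² ≤ C T^{3/2−δ}` (`T ≥ 2`) — into the estimates used by the proof of
Theorem 1 ([BettinConreyFarmer2013, §3, proof of Lemma 3]):

* `BCF.card_le` — the number of distinct zeros with `|Im ρ| ≤ U` is `≤ K U log²(U+2)`
  (from Jensen's window count, `Literature.NumberTheory.LFunctions.exists_sum_zeroOrder_div_norm_le`);
* `BCF.sum_inv_deriv_sq_le` — the two-sided form of (2): `∑_{|Im ρ| ≤ T} |ζ'(ρ)|⁻² ≤ 2C T^{3/2−δ}`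
  (conjugate zeros, `ζ'(ρ̄) = conj ζ'(ρ)`);
* `BCF.sum_inv_deriv_le` — "by the Cauchy–Schwarz inequality, (2) implies
  `∑_{|ρ| ≤ T} 1/|ζ'(ρ)| ≪ √(N(T) ∑ 1/|ζ'|²) ≪ T^{5/4−δ/2}√log T`" (p. 4 of the paper), here as
  `≤ K T^{5/4−δ/4}`;
* `BCF.summable_inv_deriv_mul_norm_rpow` — "by partial summation, `∑_ρ 1/(|ζ'(ρ)||ρ|^α)` is
  convergent for any `α > 5/4 − δ/2`" (here `α > 5/4 − δ/4`, by dyadic decomposition).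

## References

* S. Bettin, J. B. Conrey, D. W. Farmer, *An optimal choice of Dirichlet polynomials for the
  Nyman–Beurling criterion*, Proc. Steklov Inst. Math. 280 (2013), suppl. 2, S30–S36
  (arXiv:1211.5191), §3, Lemma 3 and its proof. [BettinConreyFarmer2013]
-/

noncomputable section

open Complex Filter Set Real
open scoped Topology ComplexConjugate

namespace Literature.NumberTheory.LFunctions

namespace BCF

/-! ## The non-trivial zeros under RH -/

/-- Membership in the set of non-trivial zeros: `ζ(ρ) = 0` and `0 < Re ρ < 1`. Duplicate of
`Literature.NumberTheory.LFunctions.ZetaZeros.riemannZetaNontrivialZeros.mem_iff'`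
(`WeilZeroSum.lean`), kept under its old name as a deprecated alias (dedup-00665); use
`ZetaZeros.riemannZetaNontrivialZeros.mem_iff'`. [folklore] -/
@[deprecated ZetaZeros.riemannZetaNontrivialZeros.mem_iff' (since := "2026-08-15")]
theorem mem_ntz_iff {ρ : ℂ} :
    ρ ∈ ZetaZeros.riemannZetaNontrivialZeros ↔ riemannZeta ρ = 0 ∧ 0 < ρ.re ∧ ρ.re < 1 :=
  ZetaZeros.riemannZetaNontrivialZeros.mem_iff'

/-- Under RH a non-trivial zero lies on the critical line. [folklore] -/
theorem ntz_re (hRH : RiemannHypothesis) {ρ : ℂ} (hρ : ρ ∈ ZetaZeros.riemannZetaNontrivialZeros) :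
    ρ.re = 1 / 2 :=
  re_eq_one_half_of_riemannHypothesis hRH (ZetaZeros.riemannZetaNontrivialZeros.zeta_eq_zero hρ)
    (ZetaZeros.riemannZetaNontrivialZeros.re_pos hρ)

/-- A non-trivial zero is not real (`ζ(σ) < 0` on `(0,1)`). Duplicate of
`Literature.NumberTheory.LFunctions.ZetaZeros.riemannZetaNontrivialZeros.im_ne_zero` (`WeilZeroSum.lean`),
kept under its old name as a deprecated alias (dedup-00666). [folklore] -/
@[deprecated ZetaZeros.riemannZetaNontrivialZeros.im_ne_zero (since := "2026-08-15")]
theorem ntz_im_ne_zero {ρ : ℂ} (hρ : ρ ∈ ZetaZeros.riemannZetaNontrivialZeros) : ρ.im ≠ 0 :=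
  ZetaZeros.riemannZetaNontrivialZeros.im_ne_zero hρ

/-- The conjugate of a non-trivial zero is a non-trivial zero. Duplicate of
`Literature.NumberTheory.LFunctions.ZetaZeros.riemannZetaNontrivialZeros.conj_mem` (`WeilZeroSum.lean`),
kept under its old name as a deprecated alias (dedup-00667). [folklore] -/
@[deprecated ZetaZeros.riemannZetaNontrivialZeros.conj_mem (since := "2026-08-15")]
theorem ntz_conj {ρ : ℂ} (hρ : ρ ∈ ZetaZeros.riemannZetaNontrivialZeros) :
    conj ρ ∈ ZetaZeros.riemannZetaNontrivialZeros :=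
  ZetaZeros.riemannZetaNontrivialZeros.conj_mem hρ

/-- Under RH, `‖ρ‖² = 1/4 + (Im ρ)²` for a non-trivial zero. [folklore] -/
theorem ntz_norm_sq (hRH : RiemannHypothesis) {ρ : ℂ} (hρ : ρ ∈ ZetaZeros.riemannZetaNontrivialZeros) :
    ‖ρ‖ ^ 2 = 1 / 4 + ρ.im ^ 2 := by
  rw [← Complex.normSq_eq_norm_sq, Complex.normSq_apply, ntz_re hRH hρ]; ring

/-- Under RH, `‖ρ‖ ≤ |Im ρ| + 1/2` for a non-trivial zero. [folklore] -/
theorem ntz_norm_le (hRH : RiemannHypothesis) {ρ : ℂ} (hρ : ρ ∈ ZetaZeros.riemannZetaNontrivialZeros) :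
    ‖ρ‖ ≤ |ρ.im| + 1 / 2 := by
  have h := ntz_norm_sq hRH hρ
  have h0 : 0 ≤ |ρ.im| + 1 / 2 := by positivity
  nlinarith [sq_abs ρ.im, norm_nonneg ρ, abs_nonneg ρ.im]

/-- Under RH, `1/2 ≤ ‖ρ‖` for a non-trivial zero. [folklore] -/
theorem ntz_half_le_norm (hRH : RiemannHypothesis) {ρ : ℂ} (hρ : ρ ∈ ZetaZeros.riemannZetaNontrivialZeros) :
    1 / 2 ≤ ‖ρ‖ := by
  have := Complex.abs_re_le_norm ρ
  rw [ntz_re hRH hρ] at this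
  exact le_trans (by norm_num) this

/-- Under simplicity, `ζ'(ρ) ≠ 0` at a non-trivial zero. [folklore] -/
theorem ntz_deriv_ne_zero
    (hsimp : ∀ ρ : ℂ, riemannZeta ρ = 0 → 0 < ρ.re → ρ.re < 1 → deriv riemannZeta ρ ≠ 0)
    {ρ : ℂ} (hρ : ρ ∈ ZetaZeros.riemannZetaNontrivialZeros) : deriv riemannZeta ρ ≠ 0 :=
  hsimp ρ (ZetaZeros.riemannZetaNontrivialZeros.zeta_eq_zero hρ) (ZetaZeros.riemannZetaNontrivialZeros.re_pos hρ)
    (ZetaZeros.riemannZetaNontrivialZeros.re_lt_one hρ)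

/-- `‖ζ'(ρ̄)‖ = ‖ζ'(ρ)‖`. [folklore] -/
theorem norm_deriv_conj (ρ : ℂ) : ‖deriv riemannZeta (conj ρ)‖ = ‖deriv riemannZeta ρ‖ := by
  rw [deriv_riemannZeta_conj, Complex.norm_conj]

/-- The non-trivial zeros with `|Im ρ| ≤ M` form a finite set. [folklore] -/
theorem ntz_finite_abs_im_le (M : ℝ) :
    {ρ ∈ ZetaZeros.riemannZetaNontrivialZeros | |ρ.im| ≤ M}.Finite := by
  refine ((isCompact_Icc (a := (0 : ℝ)) (b := 1)).reProdIm
    (isCompact_Icc (a := -M) (b := M))).inter_riemannZetaZeros_finite.subset ?_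
  rintro ρ ⟨hρ, hM⟩
  obtain ⟨h0, h1, h2⟩ := ZetaZeros.riemannZetaNontrivialZeros.mem_iff'.1 hρ
  exact ⟨Complex.mem_reProdIm.2 ⟨⟨h1.le, h2.le⟩, abs_le.1 hM⟩, h0⟩

/-- Under RH, a non-trivial zero with `0 < Im ρ ≤ T` lies in the box `zetaZeroBox 0 T`. [folklore] -/
theorem mem_zetaZeroBox_of_ntz {ρ : ℂ} (hρ : ρ ∈ ZetaZeros.riemannZetaNontrivialZeros)
    (h1 : 0 < ρ.im) {T : ℝ} (h2 : ρ.im ≤ T) : ρ ∈ zetaZeroBox 0 T := by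
  obtain ⟨h0, hr1, hr2⟩ := ZetaZeros.riemannZetaNontrivialZeros.mem_iff'.1 hρ
  exact ⟨h0, hr1.le, hr2.le, h1, h2⟩

/-! ## Counting distinct zeros -/

/-- **Distinct zeros up to height `U`.** Under RH there is `K > 0` with
`#{ρ : |Im ρ| ≤ U} ≤ K U log²(U + 2)` for every finite set of distinct non-trivial zeros with
`|Im ρ| ≤ U`, `U ≥ 1` (from `∑ m(ρ)/‖ρ‖ ≪ log² U`, `Literature.NumberTheory.LFunctions.exists_sum_zeroOrder_div_norm_le`,
and `‖ρ‖ ≤ U + 1/2`). [cite: MontgomeryVaughan2007, Thm. 10.13] -/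
theorem card_le (hRH : RiemannHypothesis) :
    ∃ K : ℝ, 0 < K ∧ ∀ U : ℝ, 1 ≤ U → ∀ F : Finset ℂ,
      (∀ ρ ∈ F, ρ ∈ ZetaZeros.riemannZetaNontrivialZeros ∧ |ρ.im| ≤ U) →
        (F.card : ℝ) ≤ K * U * Real.log (U + 2) ^ 2 := by
  obtain ⟨C, hC0, hC⟩ := exists_sum_zeroOrder_div_norm_le
  refine ⟨2 * C, by positivity, fun U hU F hF ↦ ?_⟩
  have hF' : ∀ ρ ∈ F, ρ ∈ zetaZerosRight ∧ |ρ.im| ≤ U := fun ρ hρ ↦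
    ⟨⟨ZetaZeros.riemannZetaNontrivialZeros.zeta_eq_zero (hF ρ hρ).1,
      by rw [ntz_re hRH (hF ρ hρ).1]; norm_num⟩, (hF ρ hρ).2⟩
  have h := hC U hU F hF'
  -- each term is at least `1/(U + 1/2) ≥ 1/(2U)`
  have hterm : ∀ ρ ∈ F, 1 / (2 * U) ≤ (riemannZetaZeroOrder ρ : ℝ) / ‖ρ‖ := by
    intro ρ hρ
    have hmem := (hF ρ hρ).1
    have h0 := (ZetaZeros.riemannZetaNontrivialZeros.mem_iff'.1 hmem).1
    have hm : (1 : ℝ) ≤ riemannZetaZeroOrder ρ := by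
      have := (riemannZetaZeroOrder_pos_iff (ne_one_of_riemannZeta_eq_zero h0)).2 h0
      exact_mod_cast this
    have hn : ‖ρ‖ ≤ 2 * U := by linarith [ntz_norm_le hRH hmem, (hF ρ hρ).2]
    have hnpos : 0 < ‖ρ‖ := lt_of_lt_of_le (by norm_num) (ntz_half_le_norm hRH hmem)
    rw [div_le_div_iff₀ (by positivity) hnpos]
    nlinarith
  have hsum : (F.card : ℝ) * (1 / (2 * U)) ≤ ∑ ρ ∈ F, (riemannZetaZeroOrder ρ : ℝ) / ‖ρ‖ := by
    rw [← nsmul_eq_mul, ← Finset.sum_const]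
    exact Finset.sum_le_sum hterm
  have hU0 : 0 < U := by linarith
  calc (F.card : ℝ) = (F.card : ℝ) * (1 / (2 * U)) * (2 * U) := by field_simp
    _ ≤ (C * Real.log (U + 2) ^ 2) * (2 * U) :=
        mul_le_mul_of_nonneg_right (hsum.trans h) (by positivity)
    _ = 2 * C * U * Real.log (U + 2) ^ 2 := by ring

/-! ## Condition (2) on both sides of the real axis -/

/-- **Two-sided form of condition (2).** If `∑_{0 < Im ρ ≤ T} |ζ'(ρ)|⁻² ≤ C T^{3/2−δ}` for
`T ≥ 2` (the boxes `zetaZeroBox 0 T`), then under RH, for every finite set `F` of distinct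
non-trivial zeros with `|Im ρ| ≤ T`, `∑_{ρ ∈ F} |ζ'(ρ)|⁻² ≤ 2C T^{3/2−δ}` (the zeros with negative
ordinate are the conjugates, with the same `|ζ'|`; RH is not needed here). [cite: BettinConreyFarmer2013, Thm. 1, condition (2)] -/
theorem sum_inv_deriv_sq_le {δ C : ℝ}
    (hC : ∀ T : ℝ, 2 ≤ T →
      ∑ᶠ ρ ∈ zetaZeroBox 0 T, 1 / ‖deriv riemannZeta ρ‖ ^ 2 ≤ C * T ^ (3 / 2 - δ))
    {T : ℝ} (hT : 2 ≤ T) (F : Finset ℂ)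
    (hF : ∀ ρ ∈ F, ρ ∈ ZetaZeros.riemannZetaNontrivialZeros ∧ |ρ.im| ≤ T) :
    ∑ ρ ∈ F, 1 / ‖deriv riemannZeta ρ‖ ^ 2 ≤ 2 * C * T ^ (3 / 2 - δ) := by
  classical
  have hbox := hC T hT
  rw [finsum_mem_eq_finite_toFinset_sum _ (zetaZeroBox_finite 0 T)] at hbox
  set B := (zetaZeroBox_finite 0 T).toFinset with hB
  have hnn : ∀ ρ : ℂ, 0 ≤ 1 / ‖deriv riemannZeta ρ‖ ^ 2 := fun ρ ↦ by positivity
  -- positive ordinates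
  set F₁ := F.filter (fun ρ ↦ 0 < ρ.im) with hF₁
  set F₂ := F.filter (fun ρ ↦ ¬ 0 < ρ.im) with hF₂
  have h1 : ∑ ρ ∈ F₁, 1 / ‖deriv riemannZeta ρ‖ ^ 2 ≤ C * T ^ (3 / 2 - δ) := by
    refine le_trans (Finset.sum_le_sum_of_subset_of_nonneg ?_ fun ρ _ _ ↦ hnn ρ) hbox
    intro ρ hρ
    rw [hF₁, Finset.mem_filter] at hρ
    rw [hB, Set.Finite.mem_toFinset]
    have habs := (hF ρ hρ.1).2
    rw [abs_of_pos hρ.2] at habs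
    exact mem_zetaZeroBox_of_ntz (hF ρ hρ.1).1 hρ.2 habs
  -- negative ordinates, by conjugation
  have h2 : ∑ ρ ∈ F₂, 1 / ‖deriv riemannZeta ρ‖ ^ 2 ≤ C * T ^ (3 / 2 - δ) := by
    have hinj : Set.InjOn (fun ρ : ℂ ↦ conj ρ) F₂ := fun a _ b _ h ↦ by
      simpa using congrArg conj h
    have e1 : ∑ ρ ∈ F₂, 1 / ‖deriv riemannZeta ρ‖ ^ 2 =
        ∑ ρ ∈ F₂, 1 / ‖deriv riemannZeta (conj ρ)‖ ^ 2 :=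
      Finset.sum_congr rfl fun ρ _ ↦ by rw [norm_deriv_conj]
    have e2 : ∑ ρ ∈ F₂, 1 / ‖deriv riemannZeta (conj ρ)‖ ^ 2 =
        ∑ z ∈ F₂.image (fun ρ : ℂ ↦ conj ρ), 1 / ‖deriv riemannZeta z‖ ^ 2 :=
      (Finset.sum_image (f := fun z ↦ 1 / ‖deriv riemannZeta z‖ ^ 2)
        fun a ha b hb h ↦ hinj ha hb h).symm
    rw [e1, e2]
    refine le_trans (Finset.sum_le_sum_of_subset_of_nonneg ?_ fun ρ _ _ ↦ hnn ρ) hbox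
    intro z hz
    rw [Finset.mem_image] at hz
    obtain ⟨ρ, hρ, rfl⟩ := hz
    rw [hF₂, Finset.mem_filter] at hρ
    have hmem := (hF ρ hρ.1).1
    have hneg : ρ.im < 0 :=
      lt_of_le_of_ne (not_lt.1 hρ.2) (ZetaZeros.riemannZetaNontrivialZeros.im_ne_zero hmem)
    rw [hB, Set.Finite.mem_toFinset]
    have habs := (hF ρ hρ.1).2
    rw [abs_of_neg hneg] at habs
    exact mem_zetaZeroBox_of_ntz (ZetaZeros.riemannZetaNontrivialZeros.conj_mem hmem) (by simpa using hneg)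
      (by simpa using habs)
  rw [← Finset.sum_filter_add_sum_filter_not F (fun ρ ↦ 0 < ρ.im)]
  linarith

/-- The constant of condition (2) is non-negative (take `T = 2`). [folklore] -/
theorem const_nonneg {δ C : ℝ}
    (hC : ∀ T : ℝ, 2 ≤ T →
      ∑ᶠ ρ ∈ zetaZeroBox 0 T, 1 / ‖deriv riemannZeta ρ‖ ^ 2 ≤ C * T ^ (3 / 2 - δ)) : 0 ≤ C := by
  have h := hC 2 le_rfl
  rw [finsum_mem_eq_finite_toFinset_sum _ (zetaZeroBox_finite 0 2)] at h
  have h0 : 0 ≤ ∑ ρ ∈ (zetaZeroBox_finite 0 2).toFinset, 1 / ‖deriv riemannZeta ρ‖ ^ 2 :=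
    Finset.sum_nonneg fun ρ _ ↦ by positivity
  have hpow : 0 < (2 : ℝ) ^ (3 / 2 - δ) := Real.rpow_pos_of_pos two_pos _
  nlinarith

/-! ## The first moment `∑ 1/|ζ'(ρ)|` by Cauchy–Schwarz -/

/-- Logarithms are absorbed into powers: for `a > 0` there is `K > 0` with
`log(T + 2) ≤ K T^a` for all `T ≥ 2`. [folklore] -/
theorem exists_log_le_rpow {a : ℝ} (ha : 0 < a) :
    ∃ K : ℝ, 0 < K ∧ ∀ T : ℝ, 2 ≤ T → Real.log (T + 2) ≤ K * T ^ a := by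
  set e : ℝ := min a 1 with he
  have he0 : 0 < e := lt_min ha one_pos
  have he1 : e ≤ 1 := min_le_right _ _
  have hea : e ≤ a := min_le_left _ _
  refine ⟨2 / e, by positivity, fun T hT ↦ ?_⟩
  have hT0 : 0 < T := by linarith
  have h1 : Real.log (T + 2) ≤ (T + 2) ^ e / e := Real.log_le_rpow_div (by linarith) he0
  have h2 : (T + 2) ^ e ≤ (2 * T) ^ e := Real.rpow_le_rpow (by linarith) (by linarith) he0.le
  have h3 : (2 * T) ^ e = 2 ^ e * T ^ e := Real.mul_rpow (by norm_num) hT0.le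
  have h4 : (2 : ℝ) ^ e ≤ 2 := by
    calc (2 : ℝ) ^ e ≤ 2 ^ (1 : ℝ) := Real.rpow_le_rpow_of_exponent_le (by norm_num) he1
      _ = 2 := Real.rpow_one 2
  have h5 : T ^ e ≤ T ^ a := Real.rpow_le_rpow_of_exponent_le (by linarith) hea
  have h6 : (T + 2) ^ e ≤ 2 * T ^ a := by
    rw [h3] at h2
    have : (2 : ℝ) ^ e * T ^ e ≤ 2 * T ^ a :=
      mul_le_mul h4 h5 (Real.rpow_nonneg hT0.le e) (by norm_num)
    linarith
  calc Real.log (T + 2) ≤ (T + 2) ^ e / e := h1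
    _ ≤ (2 * T ^ a) / e := div_le_div_of_nonneg_right h6 he0.le
    _ = 2 / e * T ^ a := by ring

/-- **`∑_{|Im ρ| ≤ T} 1/|ζ'(ρ)| ≪ T^{5/4−δ/4}`** ("by the Cauchy–Schwarz inequality, (2) implies
`∑ 1/|ζ'(ρ)| ≪ √(N(T) ∑ 1/|ζ'(ρ)|²) ≪ T^{5/4−δ/2} √log T`", [BettinConreyFarmer2013, proof of
Lemma 3]): under RH and condition (2) there is `K > 0` with `∑_{ρ ∈ F} 1/|ζ'(ρ)| ≤ K T^{5/4−δ/4}` for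
every `T ≥ 2` and every finite set `F` of distinct non-trivial zeros with `|Im ρ| ≤ T`.
[cite: BettinConreyFarmer2013, §3, proof of Lemma 3] -/
theorem sum_inv_deriv_le (hRH : RiemannHypothesis) {δ C : ℝ} (hδ : 0 < δ)
    (hC : ∀ T : ℝ, 2 ≤ T →
      ∑ᶠ ρ ∈ zetaZeroBox 0 T, 1 / ‖deriv riemannZeta ρ‖ ^ 2 ≤ C * T ^ (3 / 2 - δ)) :
    ∃ K : ℝ, 0 < K ∧ ∀ T : ℝ, 2 ≤ T → ∀ F : Finset ℂ,
      (∀ ρ ∈ F, ρ ∈ ZetaZeros.riemannZetaNontrivialZeros ∧ |ρ.im| ≤ T) →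
        ∑ ρ ∈ F, 1 / ‖deriv riemannZeta ρ‖ ≤ K * T ^ (5 / 4 - δ / 4) := by
  obtain ⟨K₀, hK₀0, hK₀⟩ := card_le hRH
  obtain ⟨Kℓ, hKℓ0, hKℓ⟩ := exists_log_le_rpow (a := δ / 8) (by positivity)
  have hC0 := const_nonneg hC
  set K : ℝ := Real.sqrt (2 * C * K₀) * Kℓ + 1 with hK
  refine ⟨K, by positivity, fun T hT F hF ↦ ?_⟩
  have hT0 : 0 < T := by linarith
  have hT1 : 1 ≤ T := by linarith
  -- Cauchy–Schwarz
  have hCS := sq_sum_le_card_mul_sum_sq (s := F) (f := fun ρ ↦ 1 / ‖deriv riemannZeta ρ‖)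
  have hcard := hK₀ T hT1 F hF
  have hsq := sum_inv_deriv_sq_le hC hT F hF
  have hsq' : ∑ ρ ∈ F, (1 / ‖deriv riemannZeta ρ‖) ^ 2 ≤ 2 * C * T ^ (3 / 2 - δ) := by
    refine le_trans (le_of_eq (Finset.sum_congr rfl fun ρ _ ↦ ?_)) hsq
    rw [one_div_pow]
  have hlog : Real.log (T + 2) ^ 2 ≤ Kℓ ^ 2 * T ^ (δ / 4) := by
    have h := hKℓ T hT
    have h0 : 0 ≤ Real.log (T + 2) := Real.log_nonneg (by linarith)
    calc Real.log (T + 2) ^ 2 ≤ (Kℓ * T ^ (δ / 8)) ^ 2 := pow_le_pow_left₀ h0 h 2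
      _ = Kℓ ^ 2 * T ^ (δ / 4) := by
          rw [mul_pow, ← Real.rpow_mul_natCast hT0.le]; congr 2; push_cast; ring
  -- the product bound
  have hprod : (F.card : ℝ) * ∑ ρ ∈ F, (1 / ‖deriv riemannZeta ρ‖) ^ 2 ≤
      (K * T ^ (5 / 4 - δ / 4)) ^ 2 := by
    have h1 : (F.card : ℝ) * ∑ ρ ∈ F, (1 / ‖deriv riemannZeta ρ‖) ^ 2 ≤
        (K₀ * T * (Kℓ ^ 2 * T ^ (δ / 4))) * (2 * C * T ^ (3 / 2 - δ)) := by
      refine mul_le_mul (hcard.trans ?_) hsq' (Finset.sum_nonneg fun ρ _ ↦ by positivity)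
        (by positivity)
      exact mul_le_mul_of_nonneg_left hlog (by positivity)
    have h2 : (K₀ * T * (Kℓ ^ 2 * T ^ (δ / 4))) * (2 * C * T ^ (3 / 2 - δ)) =
        (2 * C * K₀ * Kℓ ^ 2) * T ^ (5 / 2 - 3 * δ / 4) := by
      have e : T * T ^ (δ / 4) * T ^ (3 / 2 - δ) = T ^ (5 / 2 - 3 * δ / 4) := by
        have h1' : T * T ^ (δ / 4) = T ^ (1 + δ / 4) := by
          rw [Real.rpow_add hT0, Real.rpow_one]
        rw [h1', ← Real.rpow_add hT0]
        congr 1; ring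
      calc (K₀ * T * (Kℓ ^ 2 * T ^ (δ / 4))) * (2 * C * T ^ (3 / 2 - δ))
          = (2 * C * K₀ * Kℓ ^ 2) * (T * T ^ (δ / 4) * T ^ (3 / 2 - δ)) := by ring
        _ = (2 * C * K₀ * Kℓ ^ 2) * T ^ (5 / 2 - 3 * δ / 4) := by rw [e]
    have h3 : T ^ (5 / 2 - 3 * δ / 4) ≤ T ^ (5 / 2 - δ / 2) :=
      Real.rpow_le_rpow_of_exponent_le hT1 (by linarith)
    have h4 : 2 * C * K₀ * Kℓ ^ 2 ≤ K ^ 2 := by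
      have hs : Real.sqrt (2 * C * K₀) ^ 2 = 2 * C * K₀ := Real.sq_sqrt (by positivity)
      have : (Real.sqrt (2 * C * K₀) * Kℓ) ^ 2 ≤ K ^ 2 := by
        refine pow_le_pow_left₀ (by positivity) ?_ 2
        rw [hK]; linarith
      calc 2 * C * K₀ * Kℓ ^ 2 = (Real.sqrt (2 * C * K₀) * Kℓ) ^ 2 := by rw [mul_pow, hs]
        _ ≤ K ^ 2 := this
    have h5 : (K * T ^ (5 / 4 - δ / 4)) ^ 2 = K ^ 2 * T ^ (5 / 2 - δ / 2) := by
      rw [mul_pow, ← Real.rpow_mul_natCast hT0.le]; congr 2; push_cast; ring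
    rw [h5]
    calc (F.card : ℝ) * ∑ ρ ∈ F, (1 / ‖deriv riemannZeta ρ‖) ^ 2
        ≤ (2 * C * K₀ * Kℓ ^ 2) * T ^ (5 / 2 - 3 * δ / 4) := h1.trans (le_of_eq h2)
      _ ≤ K ^ 2 * T ^ (5 / 2 - δ / 2) :=
          mul_le_mul h4 h3 (Real.rpow_nonneg hT0.le _) (by positivity)
  have hfin : (∑ ρ ∈ F, 1 / ‖deriv riemannZeta ρ‖) ^ 2 ≤ (K * T ^ (5 / 4 - δ / 4)) ^ 2 :=
    hCS.trans hprod
  exact le_of_pow_le_pow_left₀ two_ne_zero (by positivity) hfin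

/-! ## Convergence of `∑ 1/(|ζ'(ρ)| |ρ|^α)` -/

/-- The dyadic level of a zero: `k = ⌊log₂ ⌊|Im ρ|⌋⌋`, so that `2^k ≤ |Im ρ| < 2^{k+1}` when
`|Im ρ| ≥ 1`. [folklore] -/
theorem level_bounds {ρ : ℂ} (h : 2 < |ρ.im|) :
    (2 : ℝ) ^ (Nat.log 2 ⌊|ρ.im|⌋₊) ≤ |ρ.im| ∧ |ρ.im| ≤ (2 : ℝ) ^ (Nat.log 2 ⌊|ρ.im|⌋₊ + 1) := by
  set n : ℕ := ⌊|ρ.im|⌋₊ with hn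
  have hn2 : 2 ≤ n := Nat.le_floor (by rw [Nat.cast_ofNat]; exact h.le)
  have hn0 : n ≠ 0 := by omega
  have h1 : (2 : ℕ) ^ Nat.log 2 n ≤ n := Nat.pow_log_le_self 2 hn0
  have h2 : n < 2 ^ (Nat.log 2 n + 1) := Nat.lt_pow_succ_log_self (by norm_num) n
  have hfl : (n : ℝ) ≤ |ρ.im| := Nat.floor_le (abs_nonneg _)
  have hfl' : |ρ.im| < n + 1 := Nat.lt_floor_add_one _
  constructor
  · exact_mod_cast (show ((2 ^ Nat.log 2 n : ℕ) : ℝ) ≤ n by exact_mod_cast h1).trans hfl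
  · have : (n : ℝ) + 1 ≤ (2 : ℝ) ^ (Nat.log 2 n + 1) := by exact_mod_cast h2
    linarith

/-- **Convergence of `∑_ρ 1/(|ζ'(ρ)| |ρ|^α)` for `α > 5/4 − δ/4`** ("by partial summation … the
series `∑_ρ 1/(|ζ'(ρ)||ρ|^α)` is convergent for any `α > 5/4 − δ/2`", [BettinConreyFarmer2013,
proof of Lemma 3]; here with the exponent of `sum_inv_deriv_le` and a dyadic decomposition), over
the distinct non-trivial zeros, under RH and condition (2). [cite: BettinConreyFarmer2013, §3, proof of Lemma 3] -/
theorem summable_inv_deriv_mul_norm_rpow (hRH : RiemannHypothesis) {δ C : ℝ} (hδ : 0 < δ)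
    (hC : ∀ T : ℝ, 2 ≤ T →
      ∑ᶠ ρ ∈ zetaZeroBox 0 T, 1 / ‖deriv riemannZeta ρ‖ ^ 2 ≤ C * T ^ (3 / 2 - δ))
    {α : ℝ} (hα0 : 0 < α) (hα : 5 / 4 - δ / 4 < α) :
    Summable fun ρ : ZetaZeros.riemannZetaNontrivialZeros ↦
      1 / (‖deriv riemannZeta ρ‖ * ‖(ρ : ℂ)‖ ^ α) := by
  classical
  obtain ⟨K₁, hK₁0, hK₁⟩ := sum_inv_deriv_le hRH hδ hC
  set β : ℝ := 5 / 4 - δ / 4 with hβ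
  set r : ℝ := (2 : ℝ) ^ (β - α) with hr
  have hr0 : 0 < r := Real.rpow_pos_of_pos two_pos _
  have hr1 : r < 1 := Real.rpow_lt_one_of_one_lt_of_neg (by norm_num) (by linarith)
  have hgeom : Summable fun k : ℕ ↦ K₁ * (2 : ℝ) ^ β * r ^ k :=
    (summable_geometric_of_lt_one hr0.le hr1).mul_left _
  -- the low zeros
  set S₂ := (ntz_finite_abs_im_le 2).toFinset with hS₂
  set f : ℂ → ℝ := fun ρ ↦ 1 / (‖deriv riemannZeta ρ‖ * ‖ρ‖ ^ α) with hf
  have hf0 : ∀ ρ : ℂ, 0 ≤ f ρ := fun ρ ↦ by rw [hf]; positivity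
  set B : ℝ := ∑ ρ ∈ S₂, f ρ + ∑' k : ℕ, K₁ * (2 : ℝ) ^ β * r ^ k with hB
  refine summable_of_sum_le (fun ρ ↦ hf0 ρ) (c := B) fun u ↦ ?_
  set F : Finset ℂ := u.map (Function.Embedding.subtype _) with hF
  have hsumF : ∑ x ∈ u, f (x : ℂ) = ∑ ρ ∈ F, f ρ := by rw [hF, Finset.sum_map]; rfl
  have hFmem : ∀ ρ ∈ F, ρ ∈ ZetaZeros.riemannZetaNontrivialZeros := by
    intro ρ hρ
    rw [hF, Finset.mem_map] at hρ
    obtain ⟨x, -, rfl⟩ := hρ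
    exact x.2
  change ∑ x ∈ u, f (x : ℂ) ≤ B
  rw [hsumF, ← Finset.sum_filter_add_sum_filter_not F (fun ρ : ℂ ↦ |ρ.im| ≤ 2), hB]
  refine add_le_add ?_ ?_
  · -- low zeros: a sub-sum of the fixed finite sum
    refine Finset.sum_le_sum_of_subset_of_nonneg (fun ρ hρ ↦ ?_) fun ρ _ _ ↦ hf0 ρ
    rw [Finset.mem_filter] at hρ
    rw [hS₂, Set.Finite.mem_toFinset]
    exact ⟨hFmem ρ hρ.1, hρ.2⟩
  · -- high zeros: dyadic fibres
    set F₂ := F.filter (fun ρ : ℂ ↦ ¬ |ρ.im| ≤ 2) with hF₂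
    set lvl : ℂ → ℕ := fun ρ ↦ Nat.log 2 ⌊|ρ.im|⌋₊ with hlvl
    have hF₂mem : ∀ ρ ∈ F₂, ρ ∈ ZetaZeros.riemannZetaNontrivialZeros ∧ 2 < |ρ.im| := fun ρ hρ ↦ by
      rw [hF₂, Finset.mem_filter, not_le] at hρ
      exact ⟨hFmem ρ hρ.1, hρ.2⟩
    rw [← Finset.sum_fiberwise_of_maps_to (g := lvl) (t := F₂.image lvl)
      (fun ρ hρ ↦ Finset.mem_image_of_mem _ hρ)]
    -- each fibre
    have hfib : ∀ k ∈ F₂.image lvl, ∑ ρ ∈ F₂ with lvl ρ = k, f ρ ≤ K₁ * (2 : ℝ) ^ β * r ^ k := by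
      intro k _
      have hmem : ∀ ρ ∈ F₂.filter (fun ρ ↦ lvl ρ = k),
          ρ ∈ ZetaZeros.riemannZetaNontrivialZeros ∧ (2 : ℝ) ^ k ≤ |ρ.im| ∧
            |ρ.im| ≤ (2 : ℝ) ^ (k + 1) := by
        intro ρ hρ
        rw [Finset.mem_filter] at hρ
        obtain ⟨hz, h2⟩ := hF₂mem ρ hρ.1
        have hb := level_bounds h2
        rw [show Nat.log 2 ⌊|ρ.im|⌋₊ = k from hρ.2] at hb
        exact ⟨hz, hb.1, hb.2⟩
      have hT : (2 : ℝ) ≤ (2 : ℝ) ^ (k + 1) := by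
        calc (2 : ℝ) = 2 ^ 1 := by norm_num
          _ ≤ 2 ^ (k + 1) := pow_le_pow_right₀ (by norm_num) (by omega)
      have h1 := hK₁ ((2 : ℝ) ^ (k + 1)) hT (F₂.filter fun ρ ↦ lvl ρ = k)
        fun ρ hρ ↦ ⟨(hmem ρ hρ).1, (hmem ρ hρ).2.2⟩
      -- termwise: `f ρ ≤ 2^{-kα} / |ζ'(ρ)|`
      have h2k : (0 : ℝ) < (2 : ℝ) ^ k := by positivity
      have hterm : ∀ ρ ∈ F₂.filter (fun ρ ↦ lvl ρ = k),
          f ρ ≤ ((2 : ℝ) ^ k) ^ (-α) * (1 / ‖deriv riemannZeta ρ‖) := by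
        intro ρ hρ
        obtain ⟨hz, hlow, -⟩ := hmem ρ hρ
        have hn : (2 : ℝ) ^ k ≤ ‖ρ‖ := hlow.trans (Complex.abs_im_le_norm ρ)
        have hnpos : 0 < ‖ρ‖ := h2k.trans_le hn
        have hpow : ((2 : ℝ) ^ k) ^ α ≤ ‖ρ‖ ^ α := Real.rpow_le_rpow h2k.le hn hα0.le
        rw [hf, Real.rpow_neg h2k.le]
        simp only
        rw [one_div, mul_inv, mul_one_div]
        rw [mul_comm]
        refine mul_le_mul ?_ le_rfl (by positivity) (by positivity)
        exact inv_anti₀ (Real.rpow_pos_of_pos h2k α) hpow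
      calc ∑ ρ ∈ F₂ with lvl ρ = k, f ρ
          ≤ ∑ ρ ∈ F₂ with lvl ρ = k, ((2 : ℝ) ^ k) ^ (-α) * (1 / ‖deriv riemannZeta ρ‖) :=
            Finset.sum_le_sum hterm
        _ = ((2 : ℝ) ^ k) ^ (-α) * ∑ ρ ∈ F₂ with lvl ρ = k, 1 / ‖deriv riemannZeta ρ‖ := by
            rw [Finset.mul_sum]
        _ ≤ ((2 : ℝ) ^ k) ^ (-α) * (K₁ * ((2 : ℝ) ^ (k + 1)) ^ β) :=
            mul_le_mul_of_nonneg_left h1 (Real.rpow_nonneg h2k.le _)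
        _ = K₁ * (2 : ℝ) ^ β * r ^ k := by
            rw [hr, ← Real.rpow_natCast (2 : ℝ) k, ← Real.rpow_natCast (2 : ℝ) (k + 1),
              ← Real.rpow_mul (by norm_num), ← Real.rpow_mul (by norm_num),
              ← Real.rpow_mul_natCast (by norm_num)]
            have e : ∀ a b c : ℝ, (2 : ℝ) ^ a * (K₁ * (2 : ℝ) ^ b) = K₁ * ((2 : ℝ) ^ a * (2 : ℝ) ^ b) :=
              fun a b c ↦ by ring
            rw [e _ _ 0, ← Real.rpow_add two_pos, show K₁ * (2 : ℝ) ^ β * (2 : ℝ) ^ ((β - α) * (k : ℕ)) =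
              K₁ * ((2 : ℝ) ^ β * (2 : ℝ) ^ ((β - α) * (k : ℕ))) by ring, ← Real.rpow_add two_pos]
            push_cast
            ring_nf
    calc ∑ k ∈ F₂.image lvl, ∑ ρ ∈ F₂ with lvl ρ = k, f ρ
        ≤ ∑ k ∈ F₂.image lvl, K₁ * (2 : ℝ) ^ β * r ^ k := Finset.sum_le_sum hfib
      _ ≤ ∑' k : ℕ, K₁ * (2 : ℝ) ^ β * r ^ k :=
          hgeom.sum_le_tsum _ fun k _ ↦ by positivity

/-- The case `α = 2`: `∑_ρ 1/(|ζ'(ρ)| |ρ|²) < ∞` (needs only `δ > 0`; indeed `2 > 5/4`).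
[cite: BettinConreyFarmer2013, §3, proof of Lemma 3] -/
theorem summable_inv_deriv_mul_norm_sq (hRH : RiemannHypothesis) {δ C : ℝ} (hδ : 0 < δ)
    (hC : ∀ T : ℝ, 2 ≤ T →
      ∑ᶠ ρ ∈ zetaZeroBox 0 T, 1 / ‖deriv riemannZeta ρ‖ ^ 2 ≤ C * T ^ (3 / 2 - δ)) :
    Summable fun ρ : ZetaZeros.riemannZetaNontrivialZeros ↦
      1 / (‖deriv riemannZeta ρ‖ * ‖(ρ : ℂ)‖ ^ 2) := by
  have h := summable_inv_deriv_mul_norm_rpow hRH hδ hC (α := 2) two_pos (by linarith)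
  refine h.congr fun ρ ↦ ?_
  rw [Real.rpow_two]

end BCF

end Literature.NumberTheory.LFunctions

end
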